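import Summits.QuantumFields.BalabanUV.Beta.FP.CompositeAveragingTablesTranslate
import Summits.QuantumFields.BalabanUV.Beta.FP.PerfectSecondOrderTablesInf
import Summits.QuantumFields.BalabanUV.Beta.TameKernelCalculus

/-!
# `BalabanUV.Beta.FP.PerfectSecondOrderTablesTranslate` — road «FP» for binder row D1, RULING R-FP-45 (B)∕(E) + OWNER WORD l.33765 (c): THE (Wt)-TYPE TRANSLATION ROW
# OF FILE D2's m-FOLD CARRIER `WtInf` AND OF ITS LEG-DRESSED PIN — the one-step weight `qSym Lc` is coarse-translation covariant (from the shift law of an2's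
# `symLinAvgAt`), hence so are the composite tables `MCompInf m`, `M2CompInf m` at blocking `Lc^m` (FILE `CompositeAveragingTablesTranslate`), hence
# `WtInf … m μ (y + t) ν (y′ + t) = shiftK (−Lc^m•t) (WtInf … m μ y ν y′)` (an2's `W2SymOfK_translate`), and the same for `P·(WtInf …)·Pᵀ` when `P` is `Lc^m`-shift invariant

HONEST DEPENDENCY (page 1, mandatory): continuum YM on T⁴ ⇐ BetaPertH ∧ nine spine estimates (0/9 proved); BetaPertH ⇐ (D1) ∧ (D4) ∧ CAP+tail;
G-an2-4 gates asym, D1 and NE2/3/4.  HONEST FRAMING (cell contract, verbatim): «discharging `BetaPertH` makes Bałaban's UV stability UNCONDITIONAL —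
a real constructive-QFT result; it is NOT the continuum limit and NOT the Clay problem.»  THIS MODULE DISCHARGES NOTHING of the wall: [folklore] index
bookkeeping over OUR typed objects; no `def`, no `def … : Prop`, nothing cited, 0 sorry; 0 estimates; 0∕4 row-D1 binders; NOT X1m for the literal, NOT (CONV-C), NOT SDF, NOT D1,
NOT BetaPertH, NOT continuum, NOT Clay.  «not in print; our bookkeeping».

ABSOLUTE RULE (cell charter, verbatim): «No internally-minted statement may enter as a cited fact. Every hypothesis is either kernel-proved in this package or a
verbatim quotation of a PUBLISHED theorem with page reference. The manuscript(s) under audit are NOT citable for their own disputed steps — they are the thing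
under adjudication; programme-internal (2001/route/tribunal) claims are never citable.»

CONTENTS (all [folklore]).
* §1 `symLinAvgAt_shift` (`symLinAvgAt ρ A L μ (y + t) = symLinAvgAt ρ (shift (L•t) A) L μ y`; `symAxial_add`, `segUp_add`), `shift_delta1`, **`qSym_translate`**
  (`qSym L ρ (w + t) κ (u + L•t) = qSym L ρ w κ u`).
* §2 **`MCompInf_translate`**, **`M2CompInf_translate`** (blocking `Lc^m`; `HComp_translate` ∕ `M2Comp_translate` fed with `qSym_translate`, `SymTables.hHt`, `SymTables.hmixt`).
* §3 **`WtInf_translate`** — the (Wt) row of the undressed carrier at blocking `Lc^m` from the `Lc^m`-shift invariance of the K-slot `G m` and the block-translation covariance of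
  `S∞`, `S₂∞` (at `Lc^(m+1)` these follow from the one-step rows for free: `blockCov_pow_succ`, `blockCov₂_pow_succ`); **`dress_WtInf_translate`** — the same for the leg-dressed pin `comp (comp P (WtInf …)) (trK P)` when `shiftK (−Lc^m•t) P = P`.
Provenance: D1 formalisation swarm LEAF PROVER 02, unit b2b-balaban-beta-d1-formalise-leaf-02 gen 14, 2026-08-21; OWNER GO l.33765 (c).
-/

noncomputable section

namespace Summit.QuantumFields.BalabanUV.Beta.FP.PerfectSecondOrderTablesTranslate

open Finset
open scoped BigOperators Nat
open Literature.MathematicalPhysics.QuantumFieldTheory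
open Literature.MathematicalPhysics.QuantumFieldTheory.Balaban1983to89.Beta
open AffineAveraging (Form1 Site box toSite unitVec)
open AveragingContours (shift segUp segUp_add)
open AveragingContoursRooted (ctr)
open KKTFluctuationKernel (delta1 delta1_apply)
open ExpKernelCalculus (MKer comp shiftK comp_shiftK)
open OneStepResolventKernel (Fib)
open SecondOrderResponse (W2SymOfK W2SymOfK_translate)
open Summit.QuantumFields.BalabanUV.Beta.TameKernelCalculus (trK)
open Summit.QuantumFields.BalabanUV.Beta.SymmetrisedAxialPotential (symAxial symAxial_add symLinAvgAt)
open Summit.QuantumFields.BalabanUV.Beta.SymmetrisedStepJets (SymTables)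
open Summit.QuantumFields.BalabanUV.Beta.FP.CompositeAveragingTablesInf (HComp M2Comp)
open Summit.QuantumFields.BalabanUV.Beta.FP.CompositeAveragingTablesTranslate (HComp_translate M2Comp_translate shiftK_smul)
open Summit.QuantumFields.BalabanUV.Beta.FP.PerfectSecondOrderTablesInf (qSym lamPerfect MCompInf M2CompInf WtInf WtInf_eq)

variable {d : ℕ}

/-! ## §1 The one-step (0.4) weight is coarse-translation covariant -/

/-- [folklore] **SHIFT LAW OF THE SYMMETRISED ROOTED LINEAR AVERAGING**: moving the coarse bond by `t` is averaging the form shifted by `L•t`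
(`symAxial_add`, `segUp_add`). -/
theorem symLinAvgAt_shift (ρ : Site (d + 1)) (A : Form1 (d + 1) ℝ) (L : ℕ) (μ : Fin (d + 1)) (y t : Site (d + 1)) :
    symLinAvgAt ρ A L μ (y + t) = symLinAvgAt ρ (shift ((L : ℤ) • t) A) L μ y := by
  unfold symLinAvgAt
  refine Finset.sum_congr rfl fun b _ => ?_
  have e1 : (L : ℤ) • (y + t) + ρ = ((L : ℤ) • y + ρ) + (L : ℤ) • t := by rw [smul_add]; abel
  have e2 : (L : ℤ) • (y + t) + toSite b = ((L : ℤ) • y + toSite b) + (L : ℤ) • t := by rw [smul_add]; abel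
  have e3 : (L : ℤ) • y + ρ + (L : ℤ) • t + (L : ℤ) • unitVec μ = ((L : ℤ) • y + ρ + (L : ℤ) • unitVec μ) + (L : ℤ) • t := by abel
  have e4 : (L : ℤ) • y + toSite b + (L : ℤ) • t + (L : ℤ) • unitVec μ = ((L : ℤ) • y + toSite b + (L : ℤ) • unitVec μ) + (L : ℤ) • t := by abel
  rw [e1, e2, e3, e4, symAxial_add, symAxial_add, segUp_add]

/-- [folklore] The indicator form of a shifted bond, shifted back: `shift v (δ_{(κ, u+v)}) = δ_{(κ,u)}`. -/
theorem shift_delta1 (κ : Fin (d + 1)) (u v : Site (d + 1)) : shift v (delta1 κ (u + v)) = delta1 κ u := by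
  funext κ' z
  simp only [AveragingContours.shift, delta1_apply, add_left_inj]

/-- [folklore] **THE ONE-STEP LINEARISED (0.4) WEIGHT IS COARSE-TRANSLATION COVARIANT**: `qSym L ρ (w + t) κ (u + L•t) = qSym L ρ w κ u`. -/
theorem qSym_translate (L : ℕ) (ρ : Fin (d + 1)) (w : Site (d + 1)) (κ : Fin (d + 1)) (u t : Site (d + 1)) :
    qSym L ρ (w + t) κ (u + (L : ℤ) • t) = qSym L ρ w κ u := by
  unfold qSym
  rw [symLinAvgAt_shift, shift_delta1]

/-! ## §2 The literal's composite tables translate at their own blocking -/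

section Tables

variable {Lc : ℕ} [NeZero Lc] (tabs : SymTables d Lc) (cΛ : ℝ)

/-- [our object — bookkeeping] **(T-M)_m**: `MCompInf tabs cΛ m ρ (w + t) = shiftK (−Lc^m•t) (MCompInf tabs cΛ m ρ w)`. -/
theorem MCompInf_translate (m : ℕ) (ρ : Fin (d + 1)) (w t : Site (d + 1)) :
    MCompInf tabs cΛ m ρ (w + t) = shiftK (-((((Lc ^ m : ℕ) : ℤ)) • t)) (MCompInf tabs cΛ m ρ w) := by
  unfold MCompInf
  rw [HComp_translate Lc (qSym Lc) lamPerfect tabs.H (qSym_translate Lc) tabs.hHt m ρ w t, shiftK_smul]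

/-- [our object — bookkeeping] **(T-M₂)_m**: `M2CompInf tabs cΛ m κ (u + Lc^m•t) ρ (w + t) = shiftK (−Lc^m•t) (M2CompInf tabs cΛ m κ u ρ w)`. -/
theorem M2CompInf_translate (m : ℕ) (κ : Fin (d + 1)) (u : Site (d + 1)) (ρ : Fin (d + 1)) (w t : Site (d + 1)) :
    M2CompInf tabs cΛ m κ (u + (((Lc ^ m : ℕ) : ℤ)) • t) ρ (w + t) = shiftK (-((((Lc ^ m : ℕ) : ℤ)) • t)) (M2CompInf tabs cΛ m κ u ρ w) := by
  unfold M2CompInf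
  exact M2Comp_translate Lc (qSym Lc) lamPerfect tabs.H tabs.mixFF cΛ (qSym_translate Lc) tabs.hHt tabs.hmixt m κ u ρ w t

end Tables

/-! ## §3 The (Wt) row of the carrier and of its leg-dressed pin -/

section Carrier

variable {Lc : ℕ} [NeZero Lc] {G : ℕ → MKer (d + 1) (Fib d)} (tabs : SymTables d Lc) (cΛ : ℝ)
  {Sinf : Fin (d + 1) → Site (d + 1) → MKer (d + 1) (Fib d)} {S₂inf : Fin (d + 1) → Site (d + 1) → Fin (d + 1) → Site (d + 1) → MKer (d + 1) (Fib d)}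

/-- [our object — bookkeeping] **THE (Wt) ROW OF THE m-FOLD CARRIER**: at blocking `Lc^m`, from the `Lc^m`-shift invariance of the K-slot `G m`, the block-translation
covariance of the fine stencils `S∞` (one coarse step = `Lc^m` fine steps) and of `S₂∞`, and §2 (an2's `SecondOrderResponse.W2SymOfK_translate`). -/
theorem WtInf_translate (m : ℕ) (hG : ∀ t : Site (d + 1), shiftK (-((((Lc ^ m : ℕ) : ℤ)) • t)) (G m) = G m)
    (hS : ∀ (κ : Fin (d + 1)) (u t : Site (d + 1)), Sinf κ (u + (((Lc ^ m : ℕ) : ℤ)) • t) = shiftK (-((((Lc ^ m : ℕ) : ℤ)) • t)) (Sinf κ u))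
    (hS₂ : ∀ (κ : Fin (d + 1)) (u : Site (d + 1)) (κ' : Fin (d + 1)) (u' t : Site (d + 1)),
      S₂inf κ (u + (((Lc ^ m : ℕ) : ℤ)) • t) κ' (u' + (((Lc ^ m : ℕ) : ℤ)) • t) = shiftK (-((((Lc ^ m : ℕ) : ℤ)) • t)) (S₂inf κ u κ' u'))
    (μ : Fin (d + 1)) (y : Site (d + 1)) (ν : Fin (d + 1)) (y' t : Site (d + 1)) :
    WtInf G tabs cΛ Sinf S₂inf m μ (y + t) ν (y' + t) = shiftK (-((((Lc ^ m : ℕ) : ℤ)) • t)) (WtInf G tabs cΛ Sinf S₂inf m μ y ν y') := by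
  haveI : NeZero (Lc ^ m) := ⟨pow_ne_zero _ (NeZero.ne Lc)⟩
  rw [WtInf_eq]
  exact W2SymOfK_translate hG hS (fun ρ w t' => MCompInf_translate tabs cΛ m ρ w t') hS₂
    (fun κ u ρ w t' => M2CompInf_translate tabs cΛ m κ u ρ w t') μ y ν y' t

/-- [our object — bookkeeping] **THE (Wt) ROW OF THE LEG-DRESSED PIN**: for a dressing kernel `P` invariant under the `Lc^m`-shifts (`shiftK (−Lc^m•t) P = P`, as
an2's `shiftK_piKSymBm` ∕ the NESTED-DRESS covariance letter), `P·(WtInf … m μ (y+t) ν (y′+t))·Pᵀ = shiftK (−Lc^m•t) (P·(WtInf … m μ y ν y′)·Pᵀ)`. -/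
theorem dress_WtInf_translate {P : MKer (d + 1) (Fib d)} (m : ℕ) (hP : ∀ t : Site (d + 1), shiftK (-((((Lc ^ m : ℕ) : ℤ)) • t)) P = P)
    (hG : ∀ t : Site (d + 1), shiftK (-((((Lc ^ m : ℕ) : ℤ)) • t)) (G m) = G m)
    (hS : ∀ (κ : Fin (d + 1)) (u t : Site (d + 1)), Sinf κ (u + (((Lc ^ m : ℕ) : ℤ)) • t) = shiftK (-((((Lc ^ m : ℕ) : ℤ)) • t)) (Sinf κ u))
    (hS₂ : ∀ (κ : Fin (d + 1)) (u : Site (d + 1)) (κ' : Fin (d + 1)) (u' t : Site (d + 1)),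
      S₂inf κ (u + (((Lc ^ m : ℕ) : ℤ)) • t) κ' (u' + (((Lc ^ m : ℕ) : ℤ)) • t) = shiftK (-((((Lc ^ m : ℕ) : ℤ)) • t)) (S₂inf κ u κ' u'))
    (μ : Fin (d + 1)) (y : Site (d + 1)) (ν : Fin (d + 1)) (y' t : Site (d + 1)) :
    comp (comp P (WtInf G tabs cΛ Sinf S₂inf m μ (y + t) ν (y' + t))) (trK P)
      = shiftK (-((((Lc ^ m : ℕ) : ℤ)) • t)) (comp (comp P (WtInf G tabs cΛ Sinf S₂inf m μ y ν y')) (trK P)) := by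
  rw [WtInf_translate tabs cΛ m hG hS hS₂ μ y ν y' t, ← comp_shiftK, ← comp_shiftK, hP,
    show shiftK (-((((Lc ^ m : ℕ) : ℤ)) • t)) (trK P) = trK P from by
      rw [show shiftK (-((((Lc ^ m : ℕ) : ℤ)) • t)) (trK P) = trK (shiftK (-((((Lc ^ m : ℕ) : ℤ)) • t)) P) from rfl, hP]]

/-- [folklore] **BLOCK COVARIANCE COARSENS FOR FREE**: a stencil family covariant under the `Lc`-block translations is covariant under the `Lc^(m+1)`-block translations
(`Lc^(m+1)•t = Lc•(Lc^m•t)`) — the shape `hS` of `WtInf_translate` from the one-step (St) row of `S∞`. -/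
theorem blockCov_pow_succ {Lc : ℕ} {S : Fin (d + 1) → Site (d + 1) → MKer (d + 1) (Fib d)}
    (hS : ∀ (κ : Fin (d + 1)) (u t : Site (d + 1)), S κ (u + (Lc : ℤ) • t) = shiftK (-((Lc : ℤ) • t)) (S κ u))
    (m : ℕ) (κ : Fin (d + 1)) (u t : Site (d + 1)) :
    S κ (u + (((Lc ^ (m + 1) : ℕ) : ℤ)) • t) = shiftK (-((((Lc ^ (m + 1) : ℕ) : ℤ)) • t)) (S κ u) := by
  have e : (((Lc ^ (m + 1) : ℕ) : ℤ)) • t = (Lc : ℤ) • ((((Lc ^ m : ℕ) : ℤ)) • t) := by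
    rw [smul_smul]; congr 1; push_cast; ring
  rw [e]
  exact hS κ u _

/-- [folklore] The same for a second-order stencil family (the shape `hS₂` of `WtInf_translate` from the (S₂t) row). -/
theorem blockCov₂_pow_succ {Lc : ℕ} {S₂ : Fin (d + 1) → Site (d + 1) → Fin (d + 1) → Site (d + 1) → MKer (d + 1) (Fib d)}
    (hS₂ : ∀ (κ : Fin (d + 1)) (u : Site (d + 1)) (κ' : Fin (d + 1)) (u' t : Site (d + 1)),
      S₂ κ (u + (Lc : ℤ) • t) κ' (u' + (Lc : ℤ) • t) = shiftK (-((Lc : ℤ) • t)) (S₂ κ u κ' u'))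
    (m : ℕ) (κ : Fin (d + 1)) (u : Site (d + 1)) (κ' : Fin (d + 1)) (u' t : Site (d + 1)) :
    S₂ κ (u + (((Lc ^ (m + 1) : ℕ) : ℤ)) • t) κ' (u' + (((Lc ^ (m + 1) : ℕ) : ℤ)) • t) = shiftK (-((((Lc ^ (m + 1) : ℕ) : ℤ)) • t)) (S₂ κ u κ' u') := by
  have e : (((Lc ^ (m + 1) : ℕ) : ℤ)) • t = (Lc : ℤ) • ((((Lc ^ m : ℕ) : ℤ)) • t) := by
    rw [smul_smul]; congr 1; push_cast; ring
  rw [e]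
  exact hS₂ κ u κ' u' _

end Carrier

end Summit.QuantumFields.BalabanUV.Beta.FP.PerfectSecondOrderTablesTranslate

end
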